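import Summits.BirchSwinnertonDyer.BirchSwinnertonDyer.Theorems.AlignedTransportAtTwoMainConjectureOfRankZeroBSDAtTwoCubicClosureParity
import Summits.BirchSwinnertonDyer.BirchSwinnertonDyer.Theorems.AlignedTransportAtTwoMainConjectureOfRankZeroBSDAtTwoCubicOffStratumChevalleyDoor
import HarnessLib

/-!
# Route `AlignedTransportAtTwo`, crux C2 `MainConjectureOfRankZeroBSDAtTwo` (stmt-BirchSwinnertonDyer-22298):
# THE RAMIFICATION BIT OF THE OFF-STRATUM DOOR, KERNEL — for a good-ordinary seed-cell curve with `E(ℚ)[2] = 0`, every prime of `ℚ(β)` above `2`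
# has odd ramification index ⟺ `Δ_min ≡ 1 (mod 4)`; on `Δ_min ≡ 5 (8)` the Chevalley door's bit `hodd` is DISCHARGED, on `Δ_min ≡ 3, 7 (8)` it is FALSE

HONEST FRAMING (cell `bsd-f1-sign2`, WIDTH-5 attached prover seat `bsd-line-att-p5` gen 27 on line `birth` of the lead `bsd-line-att-p2`;
`--supports` stmt-BirchSwinnertonDyer-22298, closes nothing; BSD is NOT proved by any of this; the crux C2, its verdict «blocked-on
`Rank1Residual.GreenbergMuConjectureIrreducible`» and every registered stub are untouched). THEOREMS ONLY — no definition, no named fact,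
no `sorry`. Sequel of att-p5 g26's `…CubicOffStratumChevalleyDoor` (p748062), whose docstring records the one structure bit it could not decide
(«every prime of `ℚ(β)` above `2` has odd index — true iff `Δ_min ≡ 5 (mod 8)`; NOT kernel: the residue degree of the second prime is invisible on
`c_W mod 2 = y²(y+1)`; no tree tool for `𝓞_K ⊗ ℤ₂` beyond degree-1 primes»), and third file of this gen after `…CubicResolventParity` (p751095) and
`…CubicClosureParity` (parity transfer down to `ℚ(β)` through the `S₃`-closure `ℚ(W[2]) ⊇ ℚ(β), ℚ(√Δ)`). The tool is a parity count, not a completion.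

WHAT. `W/ℚ` elliptic, globally minimal; `β ∈ ℚ̄` a root of `4x³ + b₂x² + 2b₄x + b₆`; `δ = 4∏_{i<j}(xᵢ − xⱼ)`, `δ² = Δ_min(W)`.
* **`forall_odd_ramificationIdx_adjoin_of_minimalDiscriminantInt_emod_eight_eq_five`**: `Δ_min ≡ 5 (8)` ⟹ every prime of `ℚ(β)` above `2` has ODD `e`
  (no reduction / irreducibility hypothesis: `2` is inert in `ℚ(δ)`, transfer); `forall_odd_inertiaDeg_adjoin_of_minimalDiscriminantInt_emod_four_eq_three`:
  `Δ_min ≡ 3 (4)` ⟹ every `f` above `2` in `ℚ(β)` is odd (`2` ramifies in `ℚ(δ)` with `f = 1`).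
* **`not_forall_odd_ramificationIdx_adjoin_of_minimalDiscriminantInt_emod_four_eq_three`** / `exists_even_…`: good ORDINARY at `2`, `E(ℚ)[2] = 0`,
  `Δ_min ≡ 3 (4)` ⟹ some prime of `ℚ(β)` above `2` has EVEN `e` (g26: exactly two primes above `2`; all `f` odd; `Σeᵢfᵢ = 3` is not a sum of two odd numbers).
* **`forall_odd_ramificationIdx_adjoin_iff_minimalDiscriminantInt_emod_four_eq_one`** — THE BIT: `hodd ⟺ Δ_min ≡ 1 (mod 4)` (`≡ 1 (8)`: g25/g26, three
  primes with `e = 1`; `≡ 5 (8)`: above; `≡ 3, 7 (8)`: above). With g26 the Dedekind table of `2` in `ℚ(β)` is kernel: `(1)(1)(1)` / `(1)(f=2)` / `(1)(e=2)`.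
* Door corollaries **`classicalMuVanishes_adjoin_of_minimalDiscriminantInt_emod_eight_eq_five_of_chevalley`** and
  **`mazurMainConjecture_two_of_muIneqRel_of_minimalDiscriminantInt_emod_eight_eq_five_of_chevalley`**: p748062's doors with `hodd` a theorem — on
  `Δ_min ≡ 5 (8)` the OFF-stratum class-group road into `MC₂(W)` (PRINT⁵ + MuIneqʳ verbatim + cell hypotheses) displays ONLY `h(ℚ(β))` odd and a unit
  `ε ≠ a² − 2b²`; on `Δ_min ≡ 3, 7 (8)` that door is VACUOUS (REF1 rider R267a in the kernel) — a door for that sub-cell needs a ramified prime above `2`.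
Nothing is asserted about class groups or units of any seed (no certified seed is OFF the stratum today); nothing is closed; BSD is not proved.

References: [NeukirchANT1999] Ch. I §8–§9, Ch. II §8; [Marcus2018] Ch. 3 Thm. 25; [Serre1973] Ch. II §3.3 Thm. 4; [SilvermanAEC2009] III.§1, VII.2, VIII.§1;
[Lang1990] Ch. 13 §4 Lemma 4.1; [Fukuda1994] Thm. 1 (1); [Washington1997] §13.1; [Kato2004Asterisque] Thm. 17.4; [GreenbergLNM1716] Thm. 4.1, Conj. 1.11;
tree: p751095, `…CubicClosureParity`, p748062, p747642 (`ncard_eq_two_of_not_onKilfordStratumAtTwo`), p746875, `…KilfordStratumShared`.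
-/

set_option linter.dupNamespace false
set_option autoImplicit false

noncomputable section

open scoped Classical NumberField nonZeroDivisors

namespace Summit.BirchSwinnertonDyer.BirchSwinnertonDyer.Theorems.AlignedTransportAtTwoCubicOffStratumRamification

open NumberField IsDedekindDomain
  Summit.BirchSwinnertonDyer.BirchSwinnertonDyer.Theorems.AlignedTransportAtTwoCubicResolventParity
  Summit.BirchSwinnertonDyer.BirchSwinnertonDyer.Theorems.AlignedTransportAtTwoCubicClosureParity

/-! ## §5 The seed cell: the ramification of `2` in `ℚ(β)` is decided by `Δ_min mod 8` -/

section Seed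

open Polynomial WeierstrassCurve IntermediateField Field CongruenceSubgroup
  Literature.NumberTheory.IwasawaTheory Literature.NumberTheory.GaloisRepresentations
  Literature.NumberTheory.EllipticCurves Literature.NumberTheory.EllipticCurves.Greenberg1999
  Literature.NumberTheory.EllipticCurves.ModularForms
  Literature.NumberTheory.EllipticCurves.Rank1Residual
  Literature.NumberTheory.EllipticCurves.Module
  Literature.NumberTheory.EllipticCurves.DokchitserDokchitser2012
  Summit.BirchSwinnertonDyer.Rank1Residual
  Summit.BirchSwinnertonDyer.Rank1Residual.X1.MuLambda
  Summit.BirchSwinnertonDyer.Rank1Residual.X5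
  Summit.BirchSwinnertonDyer.Rank1Residual.F1Sign2
  Summit.BirchSwinnertonDyer.BirchSwinnertonDyer.Theorems.Rank1ResidualX1Defs
  Summit.BirchSwinnertonDyer.BirchSwinnertonDyer.Theorems.AlignedTransportAtTwoKilfordStratumShared
  Summit.BirchSwinnertonDyer.BirchSwinnertonDyer.Theorems.AlignedTransportAtTwoCubicKilfordPrimes
  Summit.BirchSwinnertonDyer.BirchSwinnertonDyer.Theorems.AlignedTransportAtTwoCubicPrimesOfEmbeddings
  Summit.BirchSwinnertonDyer.BirchSwinnertonDyer.Theorems.AlignedTransportAtTwoCubicLayerOneDoors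
  Summit.BirchSwinnertonDyer.BirchSwinnertonDyer.Theorems.AlignedTransportAtTwoCubicOffStratumChevalleyDoor
  Summit.BirchSwinnertonDyer.BirchSwinnertonDyer.Theorems.AlignedTransportAtTwoFineRoad.TowerImageDelta

variable (W : WeierstrassCurve ℚ) [W.IsElliptic] [W.IsGloballyMinimal]

omit [W.IsGloballyMinimal] in
/-- `δ = 4 · ∏_{i<j}(xᵢ − xⱼ) ∈ ℚ̄` is a square root of the minimal discriminant: `δ² = Δ_min(W)` (`W` globally minimal, so `Δ_W = Δ_min`).
[cite: SilvermanAEC2009, III.§1] -/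
theorem four_mul_delta_sq : (4 * delta W (two_ne_zero : (2 : ℚ) ≠ 0)) ^ 2 = ((W.Δ : ℚ) : AlgebraicClosure ℚ) := by
  have h16 := sixteen_mul_delta_sq W (two_ne_zero : (2 : ℚ) ≠ 0)
  rw [eq_ratCast] at h16
  rw [← h16]; ring

omit [W.IsElliptic] in
/-- `gen(ℚ(δ))² = Δ_min(W)` inside the field `ℚ(δ)`. [cite: SilvermanAEC2009, III.§1] -/
theorem gen_sq_eq_minimalDiscriminantInt {δ : AlgebraicClosure ℚ} (hδ : δ ^ 2 = ((W.Δ : ℚ) : AlgebraicClosure ℚ)) :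
    (AdjoinSimple.gen ℚ δ) ^ 2 = (minimalDiscriminantInt W : ℚ⟮δ⟯) := by
  apply Subtype.ext
  rw [SubmonoidClass.coe_pow, AdjoinSimple.coe_gen, hδ, ← cast_minimalDiscriminantInt W]
  push_cast
  rfl

omit [W.IsElliptic] in
/-- `Δ_min(W) mod 8 ∉ {0, 1, 4}` ⟹ `Δ_W` is not a rational square. [folklore] -/
theorem not_isSquare_Δ_of_emod_eight (h8 : minimalDiscriminantInt W % 8 ≠ 0 ∧ minimalDiscriminantInt W % 8 ≠ 1 ∧
    minimalDiscriminantInt W % 8 ≠ 4) : ¬ IsSquare W.Δ := by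
  rw [← cast_minimalDiscriminantInt W, Rat.isSquare_intCast_iff]
  intro h
  rcases emod_eight_of_isSquare h with h' | h' | h' <;> omega

/-- **`Δ_min ≡ 5 (mod 8)` ⟹ EVERY PRIME OF `ℚ(β)` ABOVE `2` HAS ODD RAMIFICATION INDEX** — the displayed hypothesis `hodd` of the OFF-stratum
Chevalley door (`…CubicOffStratumChevalleyDoor`, p748062) DISCHARGED on the sub-cell `Δ_min ≡ 5 (8)`. `W/ℚ` elliptic and globally minimal (no
reduction hypothesis, no irreducibility hypothesis), `β ∈ ℚ̄` a root of the `2`-division cubic: `2` is inert in `ℚ(√Δ_min)` (§2), `ℚ(W[2])/ℚ(√Δ_min)`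
is Galois of odd degree (§3), so every `e` above `2` in `ℚ(W[2])`, hence in `ℚ(β)`, is odd. [cite: NeukirchANT1999, Ch. I §8–§9]
[cite: Marcus2018, Ch. 3 Thm. 25] [cite: SilvermanAEC2009, VIII.§1] -/
theorem forall_odd_ramificationIdx_adjoin_of_minimalDiscriminantInt_emod_eight_eq_five (h8 : minimalDiscriminantInt W % 8 = 5)
    {β : AlgebraicClosure ℚ} (hβ : aeval β W.twoTorsionPolynomial.toPoly = 0) :
    ∀ w : HeightOneSpectrum (𝓞 ↥(IntermediateField.adjoin ℚ ({β} : Set (AlgebraicClosure ℚ)))),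
      ((2 : ℕ) : 𝓞 ↥(IntermediateField.adjoin ℚ ({β} : Set (AlgebraicClosure ℚ)))) ∈ w.asIdeal → Odd (w.asIdeal.ramificationIdx ℤ) := by
  have hΔ : ¬ IsSquare W.Δ := not_isSquare_Δ_of_emod_eight W (by omega)
  have hδ := four_mul_delta_sq W
  set δ : AlgebraicClosure ℚ := 4 * delta W (two_ne_zero : (2 : ℚ) ≠ 0) with hδdef
  have hβint : IsIntegral ℚ δ := ((AlgebraicClosure.isAlgebraic ℚ).isAlgebraic δ).isIntegral
  haveI : FiniteDimensional ℚ ℚ⟮δ⟯ := IntermediateField.adjoin.finiteDimensional hβint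
  haveI : NumberField ℚ⟮δ⟯ := NumberField.mk
  have hK2 : Module.finrank ℚ ℚ⟮δ⟯ = 2 := finrank_adjoin_eq_two_of_sq_eq hδ hΔ
  have hgen := gen_sq_eq_minimalDiscriminantInt W hδ
  refine (parity_transfer_adjoin_root W hΔ hδ hβ 2).1 fun Q hQ h2Q => ?_
  have h2Q' : (2 : 𝓞 ℚ⟮δ⟯) ∈ Q := by simpa using h2Q
  rw [(ramificationIdx_eq_one_and_inertiaDeg_eq_two_of_sq_eq_of_emod_eight_eq_five
    hK2 hgen h8 Q h2Q').1]
  exact odd_one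

/-- **`Δ_min ≡ 3 (mod 4)` ⟹ EVERY PRIME OF `ℚ(β)` ABOVE `2` HAS ODD RESIDUE DEGREE** (`2` ramifies in `ℚ(√Δ_min)` with `f = 1`; parity transfer).
`W/ℚ` elliptic and globally minimal, `β` a root of the `2`-division cubic. [cite: NeukirchANT1999, Ch. I §8–§9] [cite: Marcus2018, Ch. 3 Thm. 25]
[cite: SilvermanAEC2009, VIII.§1] -/
theorem forall_odd_inertiaDeg_adjoin_of_minimalDiscriminantInt_emod_four_eq_three (h4 : minimalDiscriminantInt W % 4 = 3)
    {β : AlgebraicClosure ℚ} (hβ : aeval β W.twoTorsionPolynomial.toPoly = 0) :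
    ∀ w : HeightOneSpectrum (𝓞 ↥(IntermediateField.adjoin ℚ ({β} : Set (AlgebraicClosure ℚ)))),
      ((2 : ℕ) : 𝓞 ↥(IntermediateField.adjoin ℚ ({β} : Set (AlgebraicClosure ℚ)))) ∈ w.asIdeal → Odd (w.asIdeal.inertiaDeg ℤ) := by
  have hΔ : ¬ IsSquare W.Δ := not_isSquare_Δ_of_emod_eight W (by omega)
  have hδ := four_mul_delta_sq W
  set δ : AlgebraicClosure ℚ := 4 * delta W (two_ne_zero : (2 : ℚ) ≠ 0) with hδdef
  have hβint : IsIntegral ℚ δ := ((AlgebraicClosure.isAlgebraic ℚ).isAlgebraic δ).isIntegral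
  haveI : FiniteDimensional ℚ ℚ⟮δ⟯ := IntermediateField.adjoin.finiteDimensional hβint
  haveI : NumberField ℚ⟮δ⟯ := NumberField.mk
  have hK2 : Module.finrank ℚ ℚ⟮δ⟯ = 2 := finrank_adjoin_eq_two_of_sq_eq hδ hΔ
  have hgen := gen_sq_eq_minimalDiscriminantInt W hδ
  refine (parity_transfer_adjoin_root W hΔ hδ hβ 2).2 fun Q hQ h2Q => ?_
  have h2Q' : (2 : 𝓞 ℚ⟮δ⟯) ∈ Q := by simpa using h2Q
  rw [(ramificationIdx_eq_two_and_inertiaDeg_eq_one_of_sq_eq_of_emod_four_eq_three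
    hK2 hgen h4 Q h2Q').2]
  exact odd_one

/-- **`Δ_min ≡ 3 (mod 4)` ⟹ `ℚ(β)` HAS A PRIME ABOVE `2` OF EVEN RAMIFICATION INDEX** — the displayed hypothesis `hodd` of the OFF-stratum Chevalley
door is UNSATISFIABLE on the sub-cell `Δ_min ≡ 3, 7 (mod 8)` (REF1 rider R267a in the kernel). `W/ℚ` globally minimal with good ORDINARY reduction
at `2` and no rational `2`-torsion abscissa, `β` a root of the `2`-division cubic: OFF the stratum `ℚ(β)` has exactly two primes above `2` (g26
`ncard_eq_two_of_not_onKilfordStratumAtTwo`), all residue degrees above `2` are odd (previous theorem), so if all ramification indices were odd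
too, `Σ eᵢfᵢ = 3` would be a sum of two odd numbers. [cite: NeukirchANT1999, Ch. I §8–§9] [cite: Marcus2018, Ch. 3 Thm. 25] [cite: SilvermanAEC2009, VII.2, VIII.§1] -/
theorem not_forall_odd_ramificationIdx_adjoin_of_minimalDiscriminantInt_emod_four_eq_three (hord : IsOrdinaryAt W 2)
    (ht : ∀ x : ℚ, ¬ HasRationalTwoTorsionX W x) (h4 : minimalDiscriminantInt W % 4 = 3)
    {β : AlgebraicClosure ℚ} (hβ : aeval β W.twoTorsionPolynomial.toPoly = 0) :
    ¬ ∀ w : HeightOneSpectrum (𝓞 ↥(IntermediateField.adjoin ℚ ({β} : Set (AlgebraicClosure ℚ)))),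
      ((2 : ℕ) : 𝓞 ↥(IntermediateField.adjoin ℚ ({β} : Set (AlgebraicClosure ℚ)))) ∈ w.asIdeal → Odd (w.asIdeal.ramificationIdx ℤ) := by
  intro hodd
  have hf := forall_odd_inertiaDeg_adjoin_of_minimalDiscriminantInt_emod_four_eq_three W h4 hβ
  have hirr := AlignedTransportAtTwoSeed.irr_two_of_forall_not_hasRationalTwoTorsionX W ht
  have hβint : IsIntegral ℚ β := ((AlgebraicClosure.isAlgebraic ℚ).isAlgebraic β).isIntegral
  haveI : FiniteDimensional ℚ ↥(IntermediateField.adjoin ℚ ({β} : Set (AlgebraicClosure ℚ))) :=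
    IntermediateField.adjoin.finiteDimensional hβint
  haveI : NumberField ↥(IntermediateField.adjoin ℚ ({β} : Set (AlgebraicClosure ℚ))) := NumberField.mk
  have h3 : Module.finrank ℚ ↥(IntermediateField.adjoin ℚ ({β} : Set (AlgebraicClosure ℚ))) = 3 :=
    AddKatoTwo.finrank_adjoin_root_twoTorsionPolynomial_eq_three W hirr hβ
  have hs : ¬ OnKilfordStratumAtTwo W := (not_onKilfordStratumAtTwo_iff_minimalDiscriminantInt_emod_eight_ne W hord).mpr (by omega)
  have hn2 := ncard_eq_two_of_not_onKilfordStratumAtTwo _ W hord ht h3 (aeval_four_mul_gen_twoDivisionUCubic W hβ) hs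
  have hodd' := odd_ncard_setOf_mem_of_cubic h3 Nat.prime_two hodd hf
  rw [hn2] at hodd'
  exact absurd hodd' (by decide)

/-- The same as an existence statement: **a prime of `ℚ(β)` above `2` with EVEN ramification index** (indeed the second prime has `e = 2`, `f = 1`).
[cite: NeukirchANT1999, Ch. I §8–§9] [cite: Marcus2018, Ch. 3 Thm. 25] -/
theorem exists_even_ramificationIdx_adjoin_of_minimalDiscriminantInt_emod_four_eq_three (hord : IsOrdinaryAt W 2)
    (ht : ∀ x : ℚ, ¬ HasRationalTwoTorsionX W x) (h4 : minimalDiscriminantInt W % 4 = 3)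
    {β : AlgebraicClosure ℚ} (hβ : aeval β W.twoTorsionPolynomial.toPoly = 0) :
    ∃ w : HeightOneSpectrum (𝓞 ↥(IntermediateField.adjoin ℚ ({β} : Set (AlgebraicClosure ℚ)))),
      ((2 : ℕ) : 𝓞 ↥(IntermediateField.adjoin ℚ ({β} : Set (AlgebraicClosure ℚ)))) ∈ w.asIdeal ∧ Even (w.asIdeal.ramificationIdx ℤ) := by
  have h := not_forall_odd_ramificationIdx_adjoin_of_minimalDiscriminantInt_emod_four_eq_three W hord ht h4 hβ
  push Not at h
  obtain ⟨w, hw, hodd⟩ := h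
  exact ⟨w, hw, Nat.not_odd_iff_even.mp hodd⟩

/-- **THE RAMIFICATION BIT, KERNEL.** For `W/ℚ` globally minimal with good ORDINARY reduction at `2` and no rational `2`-torsion abscissa, and `β`
any root of the `2`-division cubic: **every prime of `ℚ(β)` above `2` has odd ramification index ⟺ `Δ_min(W) ≡ 1 (mod 4)`** (`Δ_min` is odd by
good reduction; `≡ 1 (8)`: three primes, all `e = 1` — att-p5 g25/g26; `≡ 5 (8)`: this file; `≡ 3, 7 (8)`: a prime with `e = 2`).
[cite: NeukirchANT1999, Ch. I §8–§9, Ch. II §8] [cite: Marcus2018, Ch. 3 Thm. 25] [cite: Serre1973, Ch. II §3.3 Thm. 4] [cite: SilvermanAEC2009, VII.2, VIII.§1] -/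
theorem forall_odd_ramificationIdx_adjoin_iff_minimalDiscriminantInt_emod_four_eq_one (hord : IsOrdinaryAt W 2)
    (ht : ∀ x : ℚ, ¬ HasRationalTwoTorsionX W x) {β : AlgebraicClosure ℚ} (hβ : aeval β W.twoTorsionPolynomial.toPoly = 0) :
    (∀ w : HeightOneSpectrum (𝓞 ↥(IntermediateField.adjoin ℚ ({β} : Set (AlgebraicClosure ℚ)))),
      ((2 : ℕ) : 𝓞 ↥(IntermediateField.adjoin ℚ ({β} : Set (AlgebraicClosure ℚ)))) ∈ w.asIdeal → Odd (w.asIdeal.ramificationIdx ℤ)) ↔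
      minimalDiscriminantInt W % 4 = 1 := by
  have h2 : ¬ (2 : ℤ) ∣ minimalDiscriminantInt W := by
    exact_mod_cast W.not_dvd_minimalDiscriminantInt_of_hasGoodReductionAtPrime 2 hord.1
  constructor
  · intro hodd
    by_contra h4
    exact not_forall_odd_ramificationIdx_adjoin_of_minimalDiscriminantInt_emod_four_eq_three W hord ht (by omega) hβ hodd
  · intro h1
    by_cases h8 : minimalDiscriminantInt W % 8 = 1
    · -- ON the stratum: three primes, each with `e = 1`
      have hirr := AlignedTransportAtTwoSeed.irr_two_of_forall_not_hasRationalTwoTorsionX W ht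
      have hβint : IsIntegral ℚ β := ((AlgebraicClosure.isAlgebraic ℚ).isAlgebraic β).isIntegral
      haveI : FiniteDimensional ℚ ↥(IntermediateField.adjoin ℚ ({β} : Set (AlgebraicClosure ℚ))) :=
        IntermediateField.adjoin.finiteDimensional hβint
      haveI : NumberField ↥(IntermediateField.adjoin ℚ ({β} : Set (AlgebraicClosure ℚ))) := NumberField.mk
      have h3 : Module.finrank ℚ ↥(IntermediateField.adjoin ℚ ({β} : Set (AlgebraicClosure ℚ))) = 3 :=
        AddKatoTwo.finrank_adjoin_root_twoTorsionPolynomial_eq_three W hirr hβ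
      have h3p := three_le_ncard_adjoin_root_twoTorsionPolynomial_of_minimalDiscriminantInt_emod_eight W hord ht h8 hβ
      intro w hw
      rw [ramificationIdx_eq_one_of_three_le_ncard _ h3 h3p w hw]
      exact odd_one
    · exact forall_odd_ramificationIdx_adjoin_of_minimalDiscriminantInt_emod_eight_eq_five W (by omega) hβ

/-! ### The OFF-stratum Chevalley door with its ramification bit discharged (`Δ_min ≡ 5 (mod 8)`) -/

/-- **`μ₂(ℚ(β)^{cyc}) = 0` on the sub-cell `Δ_min ≡ 5 (mod 8)`, ramification bit discharged**: att-p5 g26's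
`classicalMuVanishes_adjoin_of_not_onKilfordStratumAtTwo_of_chevalley` with `hodd` supplied by this file; what is still displayed is class-group /
unit data of `ℚ(β)` only — `h(ℚ(β))` odd and a unit `ε` that is not of the form `a² − 2b²`. [cite: Lang1990, Ch. 13 §4, Lemma 4.1]
[cite: Fukuda1994, Thm. 1 (1), p. 264] [cite: Washington1997, §13.1 Lemma 13.3] [cite: Marcus2018, Ch. 3 Thm. 25] -/
theorem classicalMuVanishes_adjoin_of_minimalDiscriminantInt_emod_eight_eq_five_of_chevalley (hord : IsOrdinaryAt W 2)
    (ht : ∀ x : ℚ, ¬ HasRationalTwoTorsionX W x) (h8 : minimalDiscriminantInt W % 8 = 5)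
    {β : AlgebraicClosure ℚ} (hβ : aeval β W.twoTorsionPolynomial.toPoly = 0)
    (hh : haveI : FiniteDimensional ℚ ↥(IntermediateField.adjoin ℚ ({β} : Set (AlgebraicClosure ℚ))) :=
        IntermediateField.adjoin.finiteDimensional ((AlgebraicClosure.isAlgebraic ℚ).isAlgebraic β).isIntegral
      haveI : NumberField ↥(IntermediateField.adjoin ℚ ({β} : Set (AlgebraicClosure ℚ))) := NumberField.mk
      ¬ 2 ∣ classNumber ↥(IntermediateField.adjoin ℚ ({β} : Set (AlgebraicClosure ℚ))))
    {ε : 𝓞 ↥(IntermediateField.adjoin ℚ ({β} : Set (AlgebraicClosure ℚ)))} (hεu : IsUnit ε)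
    (hnn : ∀ a b : ↥(IntermediateField.adjoin ℚ ({β} : Set (AlgebraicClosure ℚ))),
      (ε : ↥(IntermediateField.adjoin ℚ ({β} : Set (AlgebraicClosure ℚ)))) ≠ a ^ 2 - 2 * b ^ 2)
    (κP : ZpExtension ↥(IntermediateField.adjoin ℚ ({β} : Set (AlgebraicClosure ℚ))) 2) (hκP : κP.IsCyclotomic) :
    ClassicalMuVanishes κP :=
  classicalMuVanishes_adjoin_of_not_onKilfordStratumAtTwo_of_chevalley W ht
    ((not_onKilfordStratumAtTwo_iff_minimalDiscriminantInt_emod_eight_ne W hord).mpr (by omega)) hβ hh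
    (forall_odd_ramificationIdx_adjoin_of_minimalDiscriminantInt_emod_eight_eq_five W h8 hβ) hεu hnn κP hκP

/-- **THE OFF-STRATUM DOOR INTO `MC₂(W)` ON `Δ_min ≡ 5 (mod 8)`, RAMIFICATION BIT DISCHARGED.** PRINT⁵ {Kato 17.4 (1)(2) at `2`, Greenberg 4.1,
period unit, modularity, GZK} + MuIneqʳ (the registered stub VERBATIM) + the cell hypotheses (good ordinary at `2`, no rational `2`-torsion abscissa,
`Δ_W < 0`, `r_an = 0`, analytic `μ₂ = 0` on the even branch, `BSD₂(W)`) + `Δ_min(W) ≡ 5 (mod 8)` + `β` a root of the `2`-division cubic + TWO displayed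
bits of `ℚ(β)` (`h(ℚ(β))` odd, a unit not of the form `a² − 2b²`) ⟹ `MC₂(W)` — g26's `…_emod_eight_ne_one_of_chevalley` with `hodd` now a theorem.
On the complementary OFF-stratum sub-cell `Δ_min ≡ 3, 7 (mod 8)` that door is VACUOUS (`not_forall_odd_ramificationIdx_adjoin_…`).
[cite: Kato2004Asterisque, Thm. 17.4 (1)(2) (p. 273)] [cite: GreenbergLNM1716, Thm. 4.1 (p. 102) and Conj. 1.11 (p. 58)] [cite: Fukuda1994, Thm. 1 (1), p. 264]
[cite: Lang1990, Ch. 13 §4, Lemma 4.1] [cite: Marcus2018, Ch. 3 Thm. 25] -/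
theorem mazurMainConjecture_two_of_muIneqRel_of_minimalDiscriminantInt_emod_eight_eq_five_of_chevalley
    (h17 : ∀ [NeZero (W.conductorNorm ℤ)] (f : CuspForm (Gamma0 (W.conductorNorm ℤ)) 2),
      kato_divisibility_allPrimes W 2 (f := f))
    (hGr : Greenberg1999.thm41_charValue_rankZero_anyPrime)
    (hper : realPeriodRat_eq_unit_mul_plusPeriod_two) (hmod : nonempty_modularParametrizationData)
    (hGZK : rank_eq_analyticRank_of_analyticRank_le_one)
    (hI : ∀ (W : WeierstrassCurve ℚ) [W.IsElliptic] [W.IsGloballyMinimal], IsOrdinaryAt W 2 →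
      (∀ x : ℚ, ¬ HasRationalTwoTorsionX W x) →
      ∀ (κ : ZpExtension ℚ 2) (γ : Field.absoluteGaloisGroup ℚ), κ.IsCyclotomic →
      κ.IsTopGenerator γ → IsCyclotomicVariable 2 γ →
      ∀ ⦃N : ℕ⦄ [NeZero N] (f : CuspForm (Gamma0 N) 2), IsNewformOf W f →
      ∀ Gp : IwasawaAlgebra 2, iwasawaToPowerSeries 2 Gp = padicLFunction f (unitRoot W 2 : ℚ_[2]) →
      ∀ (D : W.SelmerDualData κ γ) (Yr : W.FineSelmerDualDataRelaxedInf κ γ),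
        lengthAt (IwasawaAlgebra 2) D.X ⟨IwasawaAlgebra.augIdealP 2, IwasawaAlgebra.isPrime_augIdealP_holds 2⟩ ≤
          lengthAt (IwasawaAlgebra 2) (IwasawaAlgebra 2 ⧸ Ideal.span {Gp})
              ⟨IwasawaAlgebra.augIdealP 2, IwasawaAlgebra.isPrime_augIdealP_holds 2⟩ +
            lengthAt (IwasawaAlgebra 2) Yr.X ⟨IwasawaAlgebra.augIdealP 2, IwasawaAlgebra.isPrime_augIdealP_holds 2⟩)
    (hord : IsOrdinaryAt W 2) (ht : ∀ x : ℚ, ¬ HasRationalTwoTorsionX W x) (hΔ : W.Δ < 0) (hr : W.analyticRank = 0)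
    (hμan : ∀ ⦃N : ℕ⦄ [NeZero N] (f : CuspForm (Gamma0 N) 2), IsNewformOf W f →
      ∀ G : IwasawaAlgebra 2, IsEvenBranchLiftAtTwo W f G → red G ≠ 0)
    (hbsd : BSDp W 2) (h8 : minimalDiscriminantInt W % 8 = 5)
    {β : AlgebraicClosure ℚ} (hβ : aeval β W.twoTorsionPolynomial.toPoly = 0)
    (hh : haveI : FiniteDimensional ℚ ↥(IntermediateField.adjoin ℚ ({β} : Set (AlgebraicClosure ℚ))) :=
        IntermediateField.adjoin.finiteDimensional ((AlgebraicClosure.isAlgebraic ℚ).isAlgebraic β).isIntegral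
      haveI : NumberField ↥(IntermediateField.adjoin ℚ ({β} : Set (AlgebraicClosure ℚ))) := NumberField.mk
      ¬ 2 ∣ classNumber ↥(IntermediateField.adjoin ℚ ({β} : Set (AlgebraicClosure ℚ))))
    {ε : 𝓞 ↥(IntermediateField.adjoin ℚ ({β} : Set (AlgebraicClosure ℚ)))} (hεu : IsUnit ε)
    (hnn : ∀ a b : ↥(IntermediateField.adjoin ℚ ({β} : Set (AlgebraicClosure ℚ))),
      (ε : ↥(IntermediateField.adjoin ℚ ({β} : Set (AlgebraicClosure ℚ)))) ≠ a ^ 2 - 2 * b ^ 2) :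
    MazurMainConjecture W 2 :=
  mazurMainConjecture_two_of_muIneqRel_of_minimalDiscriminantInt_emod_eight_ne_one_of_chevalley W h17 hGr hper hmod hGZK hI hord ht hΔ hr
    hμan hbsd (by omega) hβ hh (forall_odd_ramificationIdx_adjoin_of_minimalDiscriminantInt_emod_eight_eq_five W h8 hβ) hεu hnn

end Seed

end Summit.BirchSwinnertonDyer.BirchSwinnertonDyer.Theorems.AlignedTransportAtTwoCubicOffStratumRamification

end
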